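import Mathlib
import Summits.PneNP.PneNP.Theses.RamseyUncertifiable
import Summits.PneNP.PneNP.Theorems.RamseyUncertifiableRamseyNotNPCliqueCount
import Summits.PneNP.PneNP.Theorems.RamseyUncertifiableRamseyNotNPUnionArith
import Summits.PneNP.PneNP.Theorems.RamseyUncertifiableRamseyNotNPThresholdBelowPoly

/-!
# Line `Sketch` of the crux `RamseyNotNP` (stmt-PneNP-9814): RamseyDense and the capture `TCC ⇒ X`

`X = Summit.PneNP.PneNP.Theses.RamseyUncertifiable.RamseyNotNP`: the language RAMSEY₂ of codes of graphs
`⟨n, G⟩` with neither a clique nor an independent set of size `⌈2 log₂ n⌉ = Nat.clog 2 (n²)` is not in `NP`.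

This file lands the PROVABLE part of line `Sketch` (card `typical-one-sided-capture`) as helpers of the crux:

* `card_filter_compl_isNClique`, `badCount_mul_le` — complement symmetry and the union bound
  `#{G on Fin n with a homogeneous k-set} · 2^{C(k,2)} ≤ 2·C(n,k)·#graphs`, from the landed per-set count
  `stub_cliqueCount`;
* `ramseyDense_filter` / `ramseyDense` — **quantitative Erdős 1947 at the exact threshold**: for every `c > 0`,
  eventually more than `(1 - c)·#graphs` of the graphs on `Fin n` are 2-Ramsey (with the landed arithmetic
  `stub_unionArith`); `ramseyDense` (count as `Nat.card` of a subtype) is the registered sub-goal of the crux;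
* `ramseyNotNP_of_typicalCliqueCapture` — the capture **TCC ⇒ X** (TCC = the registered conjecture-grade stub
  `stub_typicalCliqueCapture` of the skeleton `Cruxes/RamseyNotNP/Lines/Sketch.lean`, taken inline as a
  hypothesis): a density-one language lies outside `NP` as soon as no `NP` language of `⌈2log₂n⌉`-clique-free
  codes has upper density one;
* `ramseyNotNP_of_planted` — **nPCR(ε) ⇒ X** for `0 < ε < 1/2` (NP-form planted-clique refutation at clique
  size `⌈n^{1/2-ε}⌉`, via the landed `stub_thresholdBelowPoly`);
* `ramseyNotNP_of_denseBreaker` — **X_{1/2} ⇒ X** (the merged line `planting-map-demibit`: every NP language of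
  density ≥ 1/2 meets the range of the Erdős planting map), again via `ramseyDense`.

The conditional theorems make the crux's open content ONE named distributional hypothesis (TCC the weakest,
X_{1/2} ⇒ TCC ⇒ X by triage-1's merge lemma); they do not close the item (TCC implies `coNP ≠ NP`). Sources: Erdős 1947; Graham–Rothschild–Spencer §4.2;
Krajíček, *Forcing with random variables and proof complexity* §29.1 (density form of generator hardness);
Barak–Hopkins–Kelner–Kothari–Moitra–Potechin 2016 (planted clique vs SoS, Remark 1.2, refutation variant).
-/

set_option linter.dupNamespace false

namespace Summit.PneNP.PneNP.Theorems.RamseyNotNP.TypicalCapture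

open Finset
open Literature.Computability.Complexity
open Summit.PneNP.PneNP.Theses.RamseyUncertifiable (RamseyNotNP)

noncomputable section
open scoped Classical

/-- Complement symmetry: `S` is an independent `k`-set of `G` iff it is a `k`-clique of `Gᶜ`, and `G ↦ Gᶜ`
is a bijection of the graphs on `Fin n`, so both counts agree. [folklore] -/
theorem card_filter_compl_isNClique (n k : ℕ) (S : Finset (Fin n)) :
    (univ.filter fun G : SimpleGraph (Fin n) => Gᶜ.IsNClique k S).card =
      (univ.filter fun G : SimpleGraph (Fin n) => G.IsNClique k S).card := by
  refine card_bij' (fun G _ => Gᶜ) (fun G _ => Gᶜ) ?_ ?_ ?_ ?_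
  · intro G hG
    simp only [mem_filter, mem_univ, true_and] at hG ⊢
    exact hG
  · intro G hG
    simp only [mem_filter, mem_univ, true_and] at hG ⊢
    simpa only [compl_compl] using hG
  · intro G _
    simp
  · intro G _
    simp

/-- **Union bound.** The graphs on `Fin n` with a homogeneous `k`-set, times `2^{C(k,2)}`, number at most
`2·C(n,k)·#graphs`: cover by the `C(n,k)` candidate sets `S` and the two ways (`S` clique / `S` independent)
and apply `stub_cliqueCount` (landed, `…CliqueCount.lean`) to each candidate set, independent sets via
`card_filter_compl_isNClique`. [folklore; Erdős 1947 union bound] -/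
theorem badCount_mul_le (n k : ℕ) :
    (univ.filter fun G : SimpleGraph (Fin n) => ¬ (G.CliqueFree k ∧ Gᶜ.CliqueFree k)).card * 2 ^ k.choose 2
      ≤ 2 * n.choose k * Fintype.card (SimpleGraph (Fin n)) := by
  have hcover : (univ.filter fun G : SimpleGraph (Fin n) => ¬ (G.CliqueFree k ∧ Gᶜ.CliqueFree k)) ⊆
      (univ.powersetCard k).biUnion fun S =>
        (univ.filter fun G : SimpleGraph (Fin n) => G.IsNClique k S) ∪
          (univ.filter fun G : SimpleGraph (Fin n) => Gᶜ.IsNClique k S) := by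
    intro G hG
    rw [mem_filter] at hG
    rw [mem_biUnion]
    by_cases h1 : G.CliqueFree k
    · have h2 : ¬ Gᶜ.CliqueFree k := fun h2 => hG.2 ⟨h1, h2⟩
      simp only [SimpleGraph.CliqueFree, not_forall, not_not] at h2
      obtain ⟨S, hS⟩ := h2
      refine ⟨S, mem_powersetCard.mpr ⟨subset_univ _, hS.card_eq⟩, mem_union_right _ ?_⟩
      simpa using hS
    · simp only [SimpleGraph.CliqueFree, not_forall, not_not] at h1
      obtain ⟨S, hS⟩ := h1
      refine ⟨S, mem_powersetCard.mpr ⟨subset_univ _, hS.card_eq⟩, mem_union_left _ ?_⟩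
      simpa using hS
  calc (univ.filter fun G : SimpleGraph (Fin n) => ¬ (G.CliqueFree k ∧ Gᶜ.CliqueFree k)).card * 2 ^ k.choose 2
      ≤ (∑ S ∈ univ.powersetCard k,
          ((univ.filter fun G : SimpleGraph (Fin n) => G.IsNClique k S).card +
            (univ.filter fun G : SimpleGraph (Fin n) => Gᶜ.IsNClique k S).card)) * 2 ^ k.choose 2 := by
        gcongr
        exact (card_le_card hcover).trans
          (card_biUnion_le.trans (sum_le_sum fun S _ => card_union_le _ _))
    _ = ∑ S ∈ univ.powersetCard k,
          2 * ((univ.filter fun G : SimpleGraph (Fin n) => G.IsNClique k S).card * 2 ^ k.choose 2) := by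
        rw [sum_mul]
        refine sum_congr rfl fun S _ => ?_
        rw [card_filter_compl_isNClique]
        ring
    _ ≤ ∑ S ∈ univ.powersetCard k, 2 * Fintype.card (SimpleGraph (Fin n)) :=
        sum_le_sum fun S _ => Nat.mul_le_mul_left 2 (stub_cliqueCount n k S)
    _ = 2 * n.choose k * Fintype.card (SimpleGraph (Fin n)) := by
        rw [sum_const, card_powersetCard, card_univ, Fintype.card_fin, smul_eq_mul]
        ring

/-- **RamseyDense — quantitative Erdős 1947 at the exact threshold `⌈2 log₂ n⌉`.** For every `c > 0`,
eventually more than `(1 - c)·#graphs` of the labelled graphs on `Fin n` have neither a clique nor an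
independent set of size `Nat.clog 2 (n²)`, i.e. the route's language RAMSEY₂ has asymptotic density `1`
(the set-builder is verbatim the one inside `RamseyNotNP`). Union bound `badCount_mul_le` plus the
threshold arithmetic `stub_unionArith` (landed, `…UnionArith.lean`) at `M = ⌈2/c⌉₊ + 1`:
`#bad · 2^{C(k,2)} · M ≤ 2·#graphs·(M·C(n,k)) < 2·#graphs·2^{C(k,2)}`, so `#bad < 2·#graphs/M < c·#graphs`.
[cite: Erdos1947] [cite: GrahamRothschildSpencer1990, §4.2 Theorem 1] -/
theorem ramseyDense_filter (c : ℝ) (hc : 0 < c) :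
    ∃ n₀ : ℕ, ∀ n ≥ n₀, (1 - c) * (Fintype.card (SimpleGraph (Fin n)) : ℝ) <
      ((univ.filter fun G : SimpleGraph (Fin n) =>
        (⟨n, G⟩ : Σ m, SimpleGraph (Fin m)) ∈
          {p : Σ m, SimpleGraph (Fin m) | p.2.CliqueFree (Nat.clog 2 (p.1 ^ 2)) ∧
            p.2ᶜ.CliqueFree (Nat.clog 2 (p.1 ^ 2))}).card : ℝ) := by
  obtain ⟨n₀, hn₀⟩ := stub_unionArith (⌈2 / c⌉₊ + 1)
  refine ⟨n₀, fun n hn => ?_⟩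
  -- abbreviations
  set k : ℕ := Nat.clog 2 (n ^ 2) with hk
  set T : ℕ := Fintype.card (SimpleGraph (Fin n)) with hT
  set M : ℕ := ⌈2 / c⌉₊ + 1 with hM
  have hB' : M * n.choose k < 2 ^ k.choose 2 := hn₀ n hn
  have hA' := badCount_mul_le n k
  -- good + bad = all
  have hsplit :
      (univ.filter fun G : SimpleGraph (Fin n) =>
          (⟨n, G⟩ : Σ m, SimpleGraph (Fin m)) ∈
            {p : Σ m, SimpleGraph (Fin m) | p.2.CliqueFree (Nat.clog 2 (p.1 ^ 2)) ∧
              p.2ᶜ.CliqueFree (Nat.clog 2 (p.1 ^ 2))}).card +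
        (univ.filter fun G : SimpleGraph (Fin n) => ¬ (G.CliqueFree k ∧ Gᶜ.CliqueFree k)).card = T := by
    have h1 : (univ.filter fun G : SimpleGraph (Fin n) =>
          (⟨n, G⟩ : Σ m, SimpleGraph (Fin m)) ∈
            {p : Σ m, SimpleGraph (Fin m) | p.2.CliqueFree (Nat.clog 2 (p.1 ^ 2)) ∧
              p.2ᶜ.CliqueFree (Nat.clog 2 (p.1 ^ 2))}) =
        (univ.filter fun G : SimpleGraph (Fin n) => G.CliqueFree k ∧ Gᶜ.CliqueFree k) := by
      ext G
      simp only [mem_filter, mem_univ, true_and, Set.mem_setOf_eq, hk]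
    rw [h1, hT, ← card_univ]
    exact card_filter_add_card_filter_not _
  -- real arithmetic
  have hTpos : (0 : ℝ) < T := by
    have : 0 < T := Fintype.card_pos
    exact_mod_cast this
  have hMc : 2 / c < (M : ℝ) := by
    have h := Nat.le_ceil (2 / c)
    rw [hM]
    push_cast
    linarith
  have hMpos : (0 : ℝ) < M := lt_trans (by positivity) hMc
  have hcM : 2 < c * M := by
    have : c * (2 / c) = 2 := by field_simp
    nlinarith
  set b : ℕ := (univ.filter fun G : SimpleGraph (Fin n) => ¬ (G.CliqueFree k ∧ Gᶜ.CliqueFree k)).card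
    with hb
  have hPpos : (0 : ℝ) < (2 : ℝ) ^ k.choose 2 := by positivity
  have hA'' : (b : ℝ) * (2 : ℝ) ^ k.choose 2 ≤ 2 * (n.choose k : ℝ) * T := by exact_mod_cast hA'
  have hB'' : (M : ℝ) * (n.choose k : ℝ) < (2 : ℝ) ^ k.choose 2 := by exact_mod_cast hB'
  -- `b · 2^C · M ≤ 2 T (M · C(n,k)) < 2 T 2^C`, so `b M < 2 T < c M T`, so `b < c T`
  have h1 : (b : ℝ) * (2 : ℝ) ^ k.choose 2 * M < 2 * T * (2 : ℝ) ^ k.choose 2 := by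
    calc (b : ℝ) * (2 : ℝ) ^ k.choose 2 * M ≤ 2 * (n.choose k : ℝ) * T * M := by
          exact mul_le_mul_of_nonneg_right hA'' hMpos.le
      _ = 2 * T * ((M : ℝ) * (n.choose k : ℝ)) := by ring
      _ < 2 * T * (2 : ℝ) ^ k.choose 2 := by
          exact mul_lt_mul_of_pos_left hB'' (by positivity)
  have h2 : (b : ℝ) * M < 2 * T := by
    have h1' : ((b : ℝ) * M) * (2 : ℝ) ^ k.choose 2 < (2 * T) * (2 : ℝ) ^ k.choose 2 := by
      calc ((b : ℝ) * M) * (2 : ℝ) ^ k.choose 2 = (b : ℝ) * (2 : ℝ) ^ k.choose 2 * M := by ring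
        _ < 2 * T * (2 : ℝ) ^ k.choose 2 := h1
    exact lt_of_mul_lt_mul_right h1' hPpos.le
  have h3 : (b : ℝ) < c * T := by
    have h' : (b : ℝ) * M < (c * T) * M := by
      calc (b : ℝ) * M < 2 * T := h2
        _ < (c * M) * T := by exact mul_lt_mul_of_pos_right hcM hTpos
        _ = (c * T) * M := by ring
    exact lt_of_mul_lt_mul_right h' hMpos.le
  -- conclude: good = T - b > (1 - c) T
  have hgood : ((univ.filter fun G : SimpleGraph (Fin n) =>
          (⟨n, G⟩ : Σ m, SimpleGraph (Fin m)) ∈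
            {p : Σ m, SimpleGraph (Fin m) | p.2.CliqueFree (Nat.clog 2 (p.1 ^ 2)) ∧
              p.2ᶜ.CliqueFree (Nat.clog 2 (p.1 ^ 2))}).card : ℝ) = T - b := by
    have h := congrArg (fun x : ℕ => (x : ℝ)) hsplit
    push_cast at h
    linarith
  rw [hgood]
  linarith

/-- **RamseyDense, registered form (instance-free count).** For every `c > 0`, eventually more than
`(1 - c)·#graphs` of the labelled graphs on `Fin n` have neither a clique nor an independent set of size
`Nat.clog 2 (n²) = ⌈2 log₂ n⌉` — quantitative Erdős 1947 at the exact threshold, with the count as `Nat.card` of a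
subtype (no decidability instance in the statement; this is the registered sub-goal `ramseyDense` of the crux).
From `ramseyDense_filter` by `Nat.subtype_card`. [cite: Erdos1947] [cite: GrahamRothschildSpencer1990, §4.2 Theorem 1] -/
theorem ramseyDense :
    ∀ c : ℝ, 0 < c → ∃ n₀ : ℕ, ∀ n ≥ n₀, (1 - c) * (Fintype.card (SimpleGraph (Fin n)) : ℝ) <
      (Nat.card {G : SimpleGraph (Fin n) //
        G.CliqueFree (Nat.clog 2 (n ^ 2)) ∧ Gᶜ.CliqueFree (Nat.clog 2 (n ^ 2))} : ℝ) := by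
  intro c hc
  obtain ⟨n₀, hn₀⟩ := ramseyDense_filter c hc
  refine ⟨n₀, fun n hn => ?_⟩
  have h := hn₀ n hn
  rw [Nat.subtype_card (univ.filter fun G : SimpleGraph (Fin n) =>
      (⟨n, G⟩ : Σ m, SimpleGraph (Fin m)) ∈
        {p : Σ m, SimpleGraph (Fin m) | p.2.CliqueFree (Nat.clog 2 (p.1 ^ 2)) ∧
          p.2ᶜ.CliqueFree (Nat.clog 2 (p.1 ^ 2))})
    (fun G => by simp only [mem_filter, mem_univ, true_and, Set.mem_setOf_eq])]
  exact h

/-- **Capture: TCC ⇒ X.** The typical one-sided capture hypothesis TCC (line `Sketch`, card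
`typical-one-sided-capture`; the registered stub `stub_typicalCliqueCapture`, conjecture-grade, stated INLINE as
the hypothesis `hD`: every `NP` language of graph codes all of whose members are `⌈2log₂n⌉`-clique-free misses a
constant fraction of all graphs on `Fin n` for infinitely many `n`) implies the crux `RamseyNotNP` BY NAME: if
RAMSEY₂ were in `NP` it would be such a language, so it would miss a `c`-fraction infinitely often, while by
`ramseyDense_filter` it eventually contains more than a `(1 - c)`-fraction. CONDITIONAL on TCC (an open hypothesis
implying `coNP ≠ NP`); unconditional in everything else. -/
theorem ramseyNotNP_of_typicalCliqueCapture
    (hD : ∀ S : Set (Σ n, SimpleGraph (Fin n)),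
      encodingGraph.toLanguage S ∈ Nondeterministic.NP →
      S ⊆ {p | p.2.CliqueFree (Nat.clog 2 (p.1 ^ 2))} →
      ∃ c : ℝ, 0 < c ∧ ∀ n₀ : ℕ, ∃ n ≥ n₀,
        ((univ.filter fun G : SimpleGraph (Fin n) => (⟨n, G⟩ : Σ m, SimpleGraph (Fin m)) ∈ S).card : ℝ) ≤
          (1 - c) * Fintype.card (SimpleGraph (Fin n))) :
    RamseyNotNP := by
  unfold Summit.PneNP.PneNP.Theses.RamseyUncertifiable.RamseyNotNP
  intro hNP
  obtain ⟨c, hc, hio⟩ := hD _ hNP (fun p hp => hp.1)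
  obtain ⟨n₀, hn₀⟩ := ramseyDense_filter c hc
  obtain ⟨n, hn, hle⟩ := hio n₀
  -- (the two `Finset.filter`s carry different `DecidablePred` instances; `convert` identifies them)
  have hle' : ((univ.filter fun G : SimpleGraph (Fin n) =>
        (⟨n, G⟩ : Σ m, SimpleGraph (Fin m)) ∈
          {p : Σ m, SimpleGraph (Fin m) | p.2.CliqueFree (Nat.clog 2 (p.1 ^ 2)) ∧
            p.2ᶜ.CliqueFree (Nat.clog 2 (p.1 ^ 2))}).card : ℝ) ≤
      (1 - c) * Fintype.card (SimpleGraph (Fin n)) := by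
    convert hle using 4
  exact absurd (hn₀ n hn) (not_lt.mpr hle')


/-- **nPCR(ε) ⇒ X** for any fixed `0 < ε < 1/2`: the NP-form planted-clique refutation hypothesis (inline
hypothesis `hP`: every `NP` language of graph codes whose large members are all `⌈n^{1/2-ε}⌉₊`-clique-free
misses a constant fraction of all graphs on `Fin n` infinitely often) implies TCC — certificates of
`ω < ⌈2log₂n⌉` are certificates of `ω ≤ ⌈n^{1/2-ε}⌉` for large `n` by `stub_thresholdBelowPoly` (landed,
`…ThresholdBelowPoly.lean`) and `CliqueFree.mono` — hence the crux by `ramseyNotNP_of_typicalCliqueCapture`.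
CONDITIONAL on nPCR(ε) (open; the standard-shape belief one polynomial scale above the Erdős threshold). -/
theorem ramseyNotNP_of_planted {ε : ℝ} (hε : 0 < ε) (hε' : ε < 1 / 2)
    (hP : ∀ S : Set (Σ n, SimpleGraph (Fin n)),
      encodingGraph.toLanguage S ∈ Nondeterministic.NP →
      (∃ N : ℕ, ∀ p ∈ S, N ≤ p.1 → p.2.CliqueFree ⌈(p.1 : ℝ) ^ (1 / 2 - ε)⌉₊) →
      ∃ c : ℝ, 0 < c ∧ ∀ n₀ : ℕ, ∃ n ≥ n₀,
        ((univ.filter fun G : SimpleGraph (Fin n) => (⟨n, G⟩ : Σ m, SimpleGraph (Fin m)) ∈ S).card : ℝ) ≤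
          (1 - c) * Fintype.card (SimpleGraph (Fin n))) :
    RamseyNotNP := by
  refine ramseyNotNP_of_typicalCliqueCapture fun S hS hsub => ?_
  obtain ⟨N, hN⟩ := stub_thresholdBelowPoly ε hε hε'
  refine hP S hS ⟨N, fun p hp hNp => ?_⟩
  exact (hsub hp).mono (hN p.1 hNp)


/-- **X_{1/2} ⇒ X** (the merged line `planting-map-demibit`, ideator 2's `DenseBreakerMeetsPlanted`, inline as
`hH`): if every `NP` language of eventual density `≥ 1/2` among the graphs on `Fin n` contains the code of a
NON-Ramsey graph (i.e. meets the range of the Erdős planting map), then RAMSEY₂ ∉ NP — since RAMSEY₂ itself has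
eventual density `> 1/2` by `ramseyDense_filter` (`c = 1/2`) and contains no non-Ramsey code. Krajíček's density form
of generator hardness (Forcing with random variables §29.1) for the planting map. CONDITIONAL on X_{1/2}. -/
theorem ramseyNotNP_of_denseBreaker
    (hH : ∀ L ∈ Nondeterministic.NP,
      (∃ n₀ : ℕ, ∀ n ≥ n₀, (Fintype.card (SimpleGraph (Fin n)) : ℝ) ≤
        2 * ((univ.filter fun G : SimpleGraph (Fin n) =>
          encodingGraph.encode (⟨n, G⟩ : Σ m, SimpleGraph (Fin m)) ∈ L).card : ℝ)) →
      ∃ p : Σ m, SimpleGraph (Fin m), encodingGraph.encode p ∈ L ∧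
        ¬ (p.2.CliqueFree (Nat.clog 2 (p.1 ^ 2)) ∧ p.2ᶜ.CliqueFree (Nat.clog 2 (p.1 ^ 2)))) :
    RamseyNotNP := by
  unfold Summit.PneNP.PneNP.Theses.RamseyUncertifiable.RamseyNotNP
  intro hNP
  -- RAMSEY₂ has eventual density ≥ 1/2 (ramseyDense at c = 1/2), in the language form `hH` expects
  have hdens : ∃ n₀ : ℕ, ∀ n ≥ n₀, (Fintype.card (SimpleGraph (Fin n)) : ℝ) ≤
      2 * ((univ.filter fun G : SimpleGraph (Fin n) =>
        encodingGraph.encode (⟨n, G⟩ : Σ m, SimpleGraph (Fin m)) ∈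
          encodingGraph.toLanguage {p : Σ m, SimpleGraph (Fin m) |
            p.2.CliqueFree (Nat.clog 2 (p.1 ^ 2)) ∧ p.2ᶜ.CliqueFree (Nat.clog 2 (p.1 ^ 2))}).card : ℝ) := by
    obtain ⟨n₀, hn₀⟩ := ramseyDense_filter (1 / 2) one_half_pos
    refine ⟨n₀, fun n hn => ?_⟩
    have h := hn₀ n hn
    have heq : (univ.filter fun G : SimpleGraph (Fin n) =>
          encodingGraph.encode (⟨n, G⟩ : Σ m, SimpleGraph (Fin m)) ∈
            encodingGraph.toLanguage {p : Σ m, SimpleGraph (Fin m) |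
              p.2.CliqueFree (Nat.clog 2 (p.1 ^ 2)) ∧ p.2ᶜ.CliqueFree (Nat.clog 2 (p.1 ^ 2))}) =
        (univ.filter fun G : SimpleGraph (Fin n) =>
          (⟨n, G⟩ : Σ m, SimpleGraph (Fin m)) ∈
            {p : Σ m, SimpleGraph (Fin m) | p.2.CliqueFree (Nat.clog 2 (p.1 ^ 2)) ∧
              p.2ᶜ.CliqueFree (Nat.clog 2 (p.1 ^ 2))}) := by
      ext G
      simp only [mem_filter, mem_univ, true_and, Computability.Encoding.mem_toLanguage_iff]
    rw [heq]
    linarith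
  obtain ⟨p, hp, hpR⟩ := hH _ hNP hdens
  exact hpR (by simpa using hp)

end

end Summit.PneNP.PneNP.Theorems.RamseyNotNP.TypicalCapture
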